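import Literature.MathematicalPhysics.QuantumFieldTheory.Balaban1983to89.B6Partition118KLevelFineSizesL0
import Literature.MathematicalPhysics.QuantumFieldTheory.Balaban1983to89.B6Partition118KLevelFineMixedCalc
/-!
# `Balaban1983to89.B6Partition118KLevelFineMixedCalcL0` — LEVEL-0 TWIN (programme G-F3′-L0, director-ym LINE №27 / UV3-NODE §24.5; plan `lit-balaban-r03/G-F3L0-PLAN.md`) of `B6Partition118KLevelFineMixedCalc`:
the same declarations, SAME NAMES AND STATEMENTS, for nested families WITH print's region `Λ₀ = T ∖ Ω₁` ADMITTED (structures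
`B6MultiLevelBoxOperatorL0.Domains` / `B6MultiLevelTorusOperatorL0.TDomains`: levels `0, …, k`, the level-`0` block a single site, `Q′₀ = id`,
finite weight `a₀` — print p.225 (2.14) «Σ_{j=0}^k … (Q′₀λ)(x) = λ(x), x ∈ Λ₀», p.229 «taking a sequence (2.1) … smallest possible domains B^j(Λ_j),
and considering the operator Δ_a defined by (2.19), (2.20) for this sequence»).  Every `D`-free object is the lineage's, consumed BY NAME; no existing
module is touched; no fact is minted.  Unit `lit-balaban-r03` (B6 fold owner, r03 gen 36); referee ref-4.  THE TWIN'S DOCUMENTATION FOLLOWS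
VERBATIM (its «levels 1 … k» / «Ω₁ = X» sentences describe the twin; here `j` runs from `0` and `Ω₁` may be a proper subset).

# `Balaban1983to89.B6Partition118KLevelFineMixedCalc` — T. Bałaban, *Propagators and renormalization transformations for lattice gauge theories. II*,
# Commun. Math. Phys. **96** (1984) 223–250 [Balaban1984PropagatorsII], p. 229 (2.36) / p. 247 (2.137); [Balaban1983RegularityDecay] §2 p. 577:
# THE FOUR-POINT (MIXED SECOND DIFFERENCE) CALCULUS OF THE FINE-PARTITION BUMPS — the real-variable product/quotient rules for
# `□f = f₁₁ − f₁₀ − f₀₁ + f₀₀` of `θ/N^{1/2}` at the corners of a unit square and the factorisation of `□` on product profiles,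
# whence **`|□θ_□| ≤ D₁²|η||η′|/(8S_□/5)²`** in two distinct axes (file 4a of p38's family `…Fine`, `…FineSizes`, `…FineSecond`; consumed by
# `…B6Partition118KLevelFineMixed`, the mixed second differences `|∇∇′h_□| ≤ O(1)(ML^jη)^{−2}` of `h_□` entering the Hölder estimate (2.137))

statement-level skeleton of published theorems with citation tags; proofs where landed; nothing here is a claim about the Yang–Mills mass gap

PDF held: `paper:balaban1984-cmp96-propagators-rt-ii` (journal page = PDF page + 222): p. 229 [PDF 7], p. 247 [PDF 25].  PRINT p. 247 (2.137)
*"‖ζ∇GJ‖_α ≤ O(1)(Lʲη)^{1−α}(‖ζ‖_α + |ζ|)e^{−δ₃d(y,y′)}|J|"*; [Balaban1983RegularityDecay] §2 p. 577 *"|∂^ηh_j| ≤ O(M⁻¹), |Δ^ηh_j| ≤ O(M⁻²)"* — the `C²`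
size of the product profile `θ_□ = Π_κ h((p_κ − c_κ)/(8S/5))`, here for the MIXED derivative `∂_μ∂_ν`, `μ ≠ ν`, where only FIRST derivatives of the
one-dimensional profile enter (`□(Πφ) = (δ_μφ_μ)(δ_νφ_ν)Π_{κ≠μ,ν}φ_κ`).

CITATION HEADER (lean-in-tree rule) — WHAT IS REPRODUCED.  Phase-2 file of the `lit-balaban` typed skeleton (HOME `run/shared/lean/pub/lit-balaban/`), seat
**p22 gen 26**, free-target (2.137)₁ at k levels (HOME/STATUS TAKING 2026-08-23T22:15Z, r03 NO OBJECTION 22:25Z); SKELETON rows **B6.Eq2.36** ×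
**B5.Eq1.118** × **B6.Prop2.6** (cells only; decls of record untouched).
* §1 (real variables, four values `N ≥ 1`): `|N₁₁^{−1/2} − N₁₀^{−1/2} − N₀₁^{−1/2} + N₀₀^{−1/2}| ≤ ½|□N| + ½|N₁₀ − N₀₀|(|N₁₁ − N₁₀| + |N₀₁ − N₀₀|)`
  (`inv_sqrt_mixed_diff_le`, exact algebra in the square roots — no Taylor remainder), the product rule
  `□(fg) = f₁₁□g + (f₁₁ − f₀₁)(g₀₁ − g₀₀) + (f₁₁ − f₁₀)(g₁₀ − g₀₀) + (□f)g₀₀` (`quot_mixed_diff_le`), its form with uniform sizes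
  (**`quot_mixed_diff_bound`**: the SAME closed form `β + m(β + α²) + 4m²α² + 2mα²` as p38's three-point `quot_second_diff_bound`) and squares
  (**`abs_sq_mixed_diff_le`**);
* §2 the product structure (**`abs_prod_mixed_diff_le`**, generic factors in `[0, 1]`) and **`abs_thetaF_mixed_diff_le`**.
No definition, no `def … : Prop`; standard axioms.  HONEST SCOPE: elementary real algebra; nothing on d = 4 or the continuum; NOT summit progress.
Unit `lit-balaban-p22` (gen 26), 2026-08-23.
-/

namespace Literature.MathematicalPhysics.QuantumFieldTheory.Balaban1983to89.B6Partition118KLevelFineMixedCalcL0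

open Finset
open Literature.MathematicalPhysics.QuantumFieldTheory.Balaban1983to89.B6MultiLevelBoxOperatorL0 (Domains)
open Literature.MathematicalPhysics.QuantumFieldTheory.Balaban1983to89.B6Cover236MultiLevelBlocksL0 (cubes ctr)
open Literature.MathematicalPhysics.QuantumFieldTheory.Balaban1983to89.B4PartitionUnity22
  (hprof contDiff_hprof hasCompactSupport_hprof hprof_nonneg hprof_le_one D1 D1_nonneg abs_sub_le_D1)
open Literature.MathematicalPhysics.QuantumFieldTheory.Balaban1983to89.B6Partition118KLevelFineL0 (sF sF_pos thetaF)
open Literature.MathematicalPhysics.QuantumFieldTheory.Balaban1983to89.B6Partition118KLevelFineSizes (inv_sqrt_sub_le)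
open Literature.MathematicalPhysics.QuantumFieldTheory.Balaban1983to89.B6Partition118KLevelFineMixedCalc (quot_mixed_diff_bound abs_sq_mixed_diff_le abs_prod_mixed_diff_le)

/-! ## §1  The four-point calculus of `θ/N^{1/2}` (real variables) -/

section Real

/-- the kernel `W(s, t) = (st(s + t))⁻¹` of `t^{−1} − s^{−1} = −(t² − s²)·W(s, t)` is `½`-Lipschitz in the square of its second argument on
`[1, ∞)²`: `|W(s, y) − W(s, x)| ≤ ½|y² − x²|`. [folklore] -/
private theorem W_sub_W_le {s x y : ℝ} (hs : 1 ≤ s) (hx : 1 ≤ x) (hy : 1 ≤ y) :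
    |(s * y * (s + y))⁻¹ - (s * x * (s + x))⁻¹| ≤ |y ^ 2 - x ^ 2| / 2 := by
  have hx0 : 0 < x := by linarith
  have hs0 : 0 < s := by linarith
  have hy0 : 0 < y := by linarith
  have eW : (s * y * (s + y))⁻¹ - (s * x * (s + x))⁻¹ = (x - y) * (s + x + y) / (s * x * y * (s + x) * (s + y)) := by
    field_simp; ring
  rw [eW, abs_div, abs_mul, abs_of_pos (by positivity : 0 < s + x + y),
    abs_of_pos (by positivity : 0 < s * x * y * (s + x) * (s + y)), div_le_iff₀ (by positivity)]
  have hxy : |x - y| * (x + y) = |y ^ 2 - x ^ 2| := by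
    rw [← abs_of_pos (by linarith : 0 < x + y), ← abs_mul, abs_sub_comm (y ^ 2) (x ^ 2)]; congr 1; ring
  have h1 : s + x + y ≤ (s + x) * (s + y) := by nlinarith
  have h2 : (1 : ℝ) ≤ s * x * y := by
    have := mul_le_mul hs hx zero_le_one (by linarith); nlinarith
  have hxy2 : |x - y| * 2 ≤ |y ^ 2 - x ^ 2| := by
    rw [← hxy]; exact mul_le_mul_of_nonneg_left (by linarith) (abs_nonneg _)
  have hA := abs_nonneg (x - y)
  calc |x - y| * (s + x + y) ≤ |x - y| * ((s + x) * (s + y)) := mul_le_mul_of_nonneg_left h1 hA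
    _ ≤ (|y ^ 2 - x ^ 2| / 2) * ((s + x) * (s + y)) := mul_le_mul_of_nonneg_right (by linarith) (by positivity)
    _ ≤ (|y ^ 2 - x ^ 2| / 2) * ((s + x) * (s + y)) * (s * x * y) := le_mul_of_one_le_right (by positivity) h2
    _ = |y ^ 2 - x ^ 2| / 2 * (s * x * y * (s + x) * (s + y)) := by ring

/-- the mixed (four-point) difference of `1/√·` at values `≥ 1`:
`|N₁₁^{−1/2} − N₁₀^{−1/2} − N₀₁^{−1/2} + N₀₀^{−1/2}| ≤ ½|N₁₁ − N₁₀ − N₀₁ + N₀₀| + ½|N₁₀ − N₀₀|(|N₁₁ − N₁₀| + |N₀₁ − N₀₀|)`. [folklore] -/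
private theorem inv_sqrt_mixed_diff_le {N00 N10 N01 N11 : ℝ} (h00 : 1 ≤ N00) (h10 : 1 ≤ N10) (h01 : 1 ≤ N01) (h11 : 1 ≤ N11) :
    |(Real.sqrt N11)⁻¹ - (Real.sqrt N10)⁻¹ - (Real.sqrt N01)⁻¹ + (Real.sqrt N00)⁻¹| ≤
      |N11 - N10 - N01 + N00| / 2 + |N10 - N00| * (|N11 - N10| + |N01 - N00|) / 2 := by
  set s00 := Real.sqrt N00 with hs00
  set s10 := Real.sqrt N10 with hs10
  set s01 := Real.sqrt N01 with hs01
  set s11 := Real.sqrt N11 with hs11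
  have h1_00 : 1 ≤ s00 := by rw [hs00, ← Real.sqrt_one]; exact Real.sqrt_le_sqrt h00
  have h1_10 : 1 ≤ s10 := by rw [hs10, ← Real.sqrt_one]; exact Real.sqrt_le_sqrt h10
  have h1_01 : 1 ≤ s01 := by rw [hs01, ← Real.sqrt_one]; exact Real.sqrt_le_sqrt h01
  have h1_11 : 1 ≤ s11 := by rw [hs11, ← Real.sqrt_one]; exact Real.sqrt_le_sqrt h11
  have sq00 : s00 ^ 2 = N00 := by rw [hs00, Real.sq_sqrt (by linarith)]
  have sq10 : s10 ^ 2 = N10 := by rw [hs10, Real.sq_sqrt (by linarith)]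
  have sq01 : s01 ^ 2 = N01 := by rw [hs01, Real.sq_sqrt (by linarith)]
  have sq11 : s11 ^ 2 = N11 := by rw [hs11, Real.sq_sqrt (by linarith)]
  have hp00 : 0 < s00 := by linarith
  have hp10 : 0 < s10 := by linarith
  have hp01 : 0 < s01 := by linarith
  have hp11 : 0 < s11 := by linarith
  set W1 : ℝ := (s01 * s11 * (s01 + s11))⁻¹ with hW1
  set W0 : ℝ := (s00 * s10 * (s00 + s10))⁻¹ with hW0
  have hW1pos : 0 < W1 := by rw [hW1]; positivity
  have hW1le : W1 ≤ 1 / 2 := by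
    rw [hW1, inv_eq_one_div]
    exact div_le_div_of_nonneg_left zero_le_one (by norm_num) (by nlinarith [mul_nonneg (sub_nonneg.2 h1_01) (sub_nonneg.2 h1_11)])
  have e1 : s11⁻¹ - s01⁻¹ = -(N11 - N01) * W1 := by rw [← sq11, ← sq01, hW1]; field_simp; ring
  have e0 : s10⁻¹ - s00⁻¹ = -(N10 - N00) * W0 := by rw [← sq10, ← sq00, hW0]; field_simp; ring
  have eM : s11⁻¹ - s10⁻¹ - s01⁻¹ + s00⁻¹ = -(N11 - N10 - N01 + N00) * W1 - (N10 - N00) * (W1 - W0) := by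
    have : s11⁻¹ - s10⁻¹ - s01⁻¹ + s00⁻¹ = (s11⁻¹ - s01⁻¹) - (s10⁻¹ - s00⁻¹) := by ring
    rw [this, e1, e0]; ring
  have hW : |W1 - W0| ≤ (|N11 - N10| + |N01 - N00|) / 2 := by
    have hA := W_sub_W_le h1_01 h1_10 h1_11
    have hB := W_sub_W_le h1_10 h1_00 h1_01
    rw [sq11, sq10] at hA
    rw [sq01, sq00] at hB
    have e : W1 - W0 = ((s01 * s11 * (s01 + s11))⁻¹ - (s01 * s10 * (s01 + s10))⁻¹) +
        ((s10 * s01 * (s10 + s01))⁻¹ - (s10 * s00 * (s10 + s00))⁻¹) := by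
      rw [hW1, hW0, show s01 * s10 * (s01 + s10) = s10 * s01 * (s10 + s01) by ring]; ring
    rw [e]
    refine (abs_add_le _ _).trans ?_
    linarith
  rw [eM]
  calc |-(N11 - N10 - N01 + N00) * W1 - (N10 - N00) * (W1 - W0)|
      ≤ |-(N11 - N10 - N01 + N00) * W1| + |(N10 - N00) * (W1 - W0)| := abs_sub _ _
    _ = |N11 - N10 - N01 + N00| * W1 + |N10 - N00| * |W1 - W0| := by rw [abs_mul, abs_mul, abs_neg, abs_of_pos hW1pos]
    _ ≤ |N11 - N10 - N01 + N00| * (1 / 2) + |N10 - N00| * ((|N11 - N10| + |N01 - N00|) / 2) :=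
        add_le_add (mul_le_mul_of_nonneg_left hW1le (abs_nonneg _)) (mul_le_mul_of_nonneg_left hW (abs_nonneg _))
    _ = _ := by ring

/-- the product rule for mixed differences of `f·N^{−1/2}` (`□(fg) = f₁₁□g + (f₁₁ − f₀₁)(g₀₁ − g₀₀) + (f₁₁ − f₁₀)(g₁₀ − g₀₀) + (□f)g₀₀`),
`f₁₁ ∈ [0, 1]`, `N ≥ 1`. [folklore] -/
private theorem quot_mixed_diff_le {f00 f10 f01 f11 N00 N10 N01 N11 : ℝ} (hf0 : 0 ≤ f11) (hf1 : f11 ≤ 1) (h00 : 1 ≤ N00) (h10 : 1 ≤ N10)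
    (h01 : 1 ≤ N01) (h11 : 1 ≤ N11) :
    |f11 / Real.sqrt N11 - f10 / Real.sqrt N10 - f01 / Real.sqrt N01 + f00 / Real.sqrt N00| ≤
      |f11 - f10 - f01 + f00| + (|N11 - N10 - N01 + N00| / 2 + |N10 - N00| * (|N11 - N10| + |N01 - N00|) / 2) +
        |f11 - f01| * (|N01 - N00| / 2) + |f11 - f10| * (|N10 - N00| / 2) := by
  set g00 := (Real.sqrt N00)⁻¹ with hg00
  set g10 := (Real.sqrt N10)⁻¹ with hg10
  set g01 := (Real.sqrt N01)⁻¹ with hg01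
  set g11 := (Real.sqrt N11)⁻¹ with hg11
  have hs00 : 1 ≤ Real.sqrt N00 := by rw [← Real.sqrt_one]; exact Real.sqrt_le_sqrt h00
  have hg0 : 0 ≤ g00 := by rw [hg00]; positivity
  have hg1 : g00 ≤ 1 := by rw [hg00]; exact inv_le_one_of_one_le₀ hs00
  have e : f11 / Real.sqrt N11 - f10 / Real.sqrt N10 - f01 / Real.sqrt N01 + f00 / Real.sqrt N00 =
      f11 * (g11 - g10 - g01 + g00) + g00 * (f11 - f10 - f01 + f00) + (f11 - f01) * (g01 - g00) + (f11 - f10) * (g10 - g00) := by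
    simp only [div_eq_mul_inv, hg00, hg10, hg01, hg11]; ring
  rw [e]
  have h1 : |f11 * (g11 - g10 - g01 + g00)| ≤ |N11 - N10 - N01 + N00| / 2 + |N10 - N00| * (|N11 - N10| + |N01 - N00|) / 2 := by
    rw [abs_mul, abs_of_nonneg hf0]
    calc f11 * |g11 - g10 - g01 + g00| ≤ 1 * |g11 - g10 - g01 + g00| := mul_le_mul_of_nonneg_right hf1 (abs_nonneg _)
      _ ≤ _ := by rw [one_mul]; exact inv_sqrt_mixed_diff_le h00 h10 h01 h11
  have h2 : |g00 * (f11 - f10 - f01 + f00)| ≤ |f11 - f10 - f01 + f00| := by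
    rw [abs_mul, abs_of_nonneg hg0]
    calc g00 * |f11 - f10 - f01 + f00| ≤ 1 * |f11 - f10 - f01 + f00| := mul_le_mul_of_nonneg_right hg1 (abs_nonneg _)
      _ = _ := one_mul _
  have h3 : |(f11 - f01) * (g01 - g00)| ≤ |f11 - f01| * (|N01 - N00| / 2) := by
    rw [abs_mul]; exact mul_le_mul_of_nonneg_left (inv_sqrt_sub_le h00 h01) (abs_nonneg _)
  have h4 : |(f11 - f10) * (g10 - g00)| ≤ |f11 - f10| * (|N10 - N00| / 2) := by
    rw [abs_mul]; exact mul_le_mul_of_nonneg_left (inv_sqrt_sub_le h00 h10) (abs_nonneg _)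
  calc |f11 * (g11 - g10 - g01 + g00) + g00 * (f11 - f10 - f01 + f00) + (f11 - f01) * (g01 - g00) + (f11 - f10) * (g10 - g00)|
      ≤ |f11 * (g11 - g10 - g01 + g00)| + |g00 * (f11 - f10 - f01 + f00)| + |(f11 - f01) * (g01 - g00)| +
          |(f11 - f10) * (g10 - g00)| := by
        refine (abs_add_le _ _).trans (add_le_add ((abs_add_le _ _).trans (add_le_add (abs_add_le _ _) le_rfl)) le_rfl)
    _ ≤ _ := by linarith

end Real

/-! ## §2  The product structure: mixed differences of a product profile factor -/

section Prod

variable {ι : Type*} [Fintype ι] [DecidableEq ι]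

/-- a product profile at a point moved along two distinct axes: the two factors change, the others do not. [folklore] -/
private theorem prod_update_update (φ : ι → ℝ → ℝ) (p : ι → ℝ) {μ ν : ι} (hμν : μ ≠ ν) (a b : ℝ) :
    ∏ κ, φ κ (Function.update (Function.update p μ a) ν b κ) =
      φ μ a * φ ν b * ∏ κ ∈ (univ.erase μ).erase ν, φ κ (p κ) := by
  rw [← Finset.mul_prod_erase univ _ (mem_univ μ),
    ← Finset.mul_prod_erase (univ.erase μ) _ (Finset.mem_erase.2 ⟨hμν.symm, mem_univ ν⟩),
    Function.update_of_ne hμν, Function.update_self, Function.update_self, mul_assoc]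
  congr 2
  refine Finset.prod_congr rfl fun κ hκ => ?_
  have hκν : κ ≠ ν := Finset.ne_of_mem_erase hκ
  have hκμ : κ ≠ μ := Finset.ne_of_mem_erase (Finset.mem_of_mem_erase hκ)
  rw [Function.update_of_ne hκν, Function.update_of_ne hκμ]

end Prod

variable {d : ℕ} {ℓ Mh k R : ℕ} {P : Fin (d + 1) → ℕ} (D : Domains d ℓ Mh k P R)

/-- **«|∇∇′θ_□| ≤ O(1)(ML^jη)^{−2}» IN TWO DISTINCT AXES, UNIFORMLY IN THE STEPS**:
`|θ_□(p + ηe_μ + η′e_ν) − θ_□(p + ηe_μ) − θ_□(p + η′e_ν) + θ_□(p)| ≤ D₁²|η||η′|/(8S/5)²`.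
[cite: Balaban1984PropagatorsII, p.247 after (2.134) / (2.137); Balaban1983RegularityDecay, §2 p.577] -/
theorem abs_thetaF_mixed_diff_le (hMh : 1 ≤ Mh) (i : ↥(B6Cover236MultiLevelBlocksL0.cubes D)) (p : Fin (d + 1) → ℝ) {μ ν : Fin (d + 1)} (hμν : μ ≠ ν) (η η' : ℝ) :
    |thetaF D i (Function.update (Function.update p μ (p μ + η)) ν (p ν + η')) - thetaF D i (Function.update p μ (p μ + η)) -
        thetaF D i (Function.update p ν (p ν + η')) + thetaF D i p| ≤ D1 hprof * |η| / sF D i * (D1 hprof * |η'| / sF D i) := by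
  have hs := sF_pos D hMh i
  have hD1 := D1_nonneg contDiff_hprof hasCompactSupport_hprof
  set φ : Fin (d + 1) → ℝ → ℝ := fun κ t => hprof ((t - ctr D i κ) / sF D i) with hφ
  have h := abs_prod_mixed_diff_le φ (fun κ t => hprof_nonneg _) (fun κ t => hprof_le_one _) p hμν (p μ + η) (p ν + η')
  have hμ : |φ μ (p μ + η) - φ μ (p μ)| ≤ D1 hprof * |η| / sF D i := by
    have h1 := abs_sub_le_D1 contDiff_hprof hasCompactSupport_hprof ((p μ - ctr D i μ) / sF D i) ((p μ + η - ctr D i μ) / sF D i)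
    rw [show (p μ + η - ctr D i μ) / sF D i - (p μ - ctr D i μ) / sF D i = η / sF D i by ring, abs_div, abs_of_pos hs] at h1
    simpa only [hφ, mul_div_assoc] using h1
  have hν : |φ ν (p ν + η') - φ ν (p ν)| ≤ D1 hprof * |η'| / sF D i := by
    have h1 := abs_sub_le_D1 contDiff_hprof hasCompactSupport_hprof ((p ν - ctr D i ν) / sF D i) ((p ν + η' - ctr D i ν) / sF D i)
    rw [show (p ν + η' - ctr D i ν) / sF D i - (p ν - ctr D i ν) / sF D i = η' / sF D i by ring, abs_div, abs_of_pos hs] at h1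
    simpa only [hφ, mul_div_assoc] using h1
  have key := h.trans (mul_le_mul hμ hν (abs_nonneg _) (div_nonneg (mul_nonneg hD1 (abs_nonneg _)) hs.le))
  simpa only [thetaF, hφ] using key

end Literature.MathematicalPhysics.QuantumFieldTheory.Balaban1983to89.B6Partition118KLevelFineMixedCalcL0
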